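import Summits.NavierStokesRegularity.NavierStokesRegularity.Theses.RootDecompOnsagerEdge
import Summits.NavierStokesRegularity.NavierStokesRegularity.Theorems.RootDecompStaticSkirtOnsagerSeam

/-!
# N29 «ONSAGER EDGE» — the seam item `OnsagerSeam` CLOSED by the landed seam theorem

`OnsagerSeam := EulerGaugeEngine → ConicalSkirtCubicGauge → ConicalSkirtNoAnomaly → QuietSkirtIsLaminar →
RootDecompStaticSkirt.NoTameConicalJoltingSkirt` (route `RootDecompOnsagerEdge`, support item) is, up to unfolding the
item texts, `Theorems/RootDecompStaticSkirtOnsagerSeam.lean`'s `noTameConicalJoltingSkirt_of_onsager` (p777710; lens-6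
g16 K6–K8 + the engine kill p776890).  Sources: CKN 1982 §2; Seregin 2026 (1.7)/(3.1); lens HOME/decomp-ns-lens-6/OnsagerEdge.lean.
-/

namespace Summit.NavierStokesRegularity.NavierStokesRegularity.Theorems

/-- **LJᶜ ⟸ X_E ∧ CC ∧ NA ∧ QL** — the Onsager-edge seam of the static-skirt cell, i.e. the route item
`RootDecompOnsagerEdge.OnsagerSeam`, from the landed kernel theorem `noTameConicalJoltingSkirt_of_onsager`. -/
theorem rootDecompOnsagerEdge_onsagerSeam_proof : Theses.RootDecompOnsagerEdge.OnsagerSeam :=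
  fun hXE hCC hNA hQL =>
    RootDecompStaticSkirtOnsagerSeam.noTameConicalJoltingSkirt_of_onsager hXE hCC hNA hQL

end Summit.NavierStokesRegularity.NavierStokesRegularity.Theorems
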